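import Summits.QuantumFields.BalabanUV.Beta.SymCorrectorRest
import Summits.QuantumFields.BalabanUV.Beta.D1BFx.PackedPairBlockIndexedMass
import Summits.QuantumFields.BalabanUV.Beta.D1BFx.PackedPairFaceSumMass

/-!
# `BalabanUV.Beta.D1BFx.PackedPairFaceContactMass` — road «BF-x» junction (J1), the PAIR contact family of the words file's (W-pair) word (leaf-03's TT6
# `SymCorrectorRest.slotPsiS₂_expand`): **«PAIR-FACE-CONTACT» — ONE `hTB` AND ONE (M-b) PACKED BI-VERTEX ROW FOR THE CONTACT FAMILY `Ψ̂_S∘Ψ̂_S S₂ − S₂`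
# AND FOR THE TRANSPORTED FAMILY `Ψ̂_S∘Ψ̂_S S₂`, FROM ONE DISPLAYED PER-SLOT-PAIR LETTER OF THE RAW PAIR TABLE** (UNCONDITIONAL; [folklore] bookkeeping BY NAME
# over TT6 §5, «PAIR-FACE-PACK» §1–§2, «PAIR-FACE-SUM-MASS», FILE 6 §3) — the pair twin of the g58 five-file capstone, with the face-sum letters PROVED

HONEST DEPENDENCY (cell records, verbatim): «continuum YM on T⁴ ⇐ BetaPertH ∧ nine spine estimates (0/9 proved); BetaPertH ⇐ (D1) ∧ (D4) ∧
CAP+tail; G-an2-4 gates asym, D1 and NE2/3/4.»  HONEST FRAMING (cell contract, verbatim): «discharging `BetaPertH` makes Bałaban's UV stability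
UNCONDITIONAL — a real constructive-QFT result; it is NOT the continuum limit and NOT the Clay problem.»  THIS MODULE DISCHARGES NOTHING of the
wall: [folklore] `ℓ¹` bookkeeping BY NAME (leaf-03's `SymCorrectorRest.slotPsiS₂_expand`, this lineage's `PackedPairBlockIndexedMass.blockPairTotal_add_le ∕ hTB_of_outerIndexed ∕
hTB_of_innerIndexed ∕ hTB_of_bothIndexed`, `PackedPairFaceSumMass` §2, `PackedColumnBlockTotalScales.mass_blk_vertex2OfK_G₀_le_of_blockPairTotal_at`, leaf-03's
`PackedCoframeSep.mass_add_le ∕ mass_smul_le`).  The ONE letter is a DISPLAYED hypothesis on an ARBITRARY pair family `S₂` (`hBm` + plain summability `hBs`); the face weights'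
block-ℓ¹ law is DISPLAYED (`hcB`, §3) or DISCHARGED at the centred root `ρ_c = ctrOff (3+1) N` (`cW = 3+1`, §4, «COMB-WEIGHT-BLOCK-L1»); nothing of Bałaban's (or an1's ∕
an3's) tables asserted.  No definition, no `def … : Prop`, nothing cited, 0 sorry.  NO (1.22) row and no [M] row PRICED (the road types no [M] row on the contact families
before the decider, OWNER d1-p2 g23 W-g23-3); 0 root-level binders of row D1 discharged; (J1) = ONE OPEN ROW; [W] OPEN; (K) NOT closed; NOT D1, NOT `BetaPertH`,
NOT continuum, NOT Clay.

ABSOLUTE RULE (cell charter, verbatim): «No internally-minted statement may enter as a cited fact. Every hypothesis is either kernel-proved in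
this package or a verbatim quotation of a PUBLISHED theorem with page reference. The manuscript(s) under audit are NOT citable for their own
disputed steps — they are the thing under adjudication; programme-internal (2001/route/tribunal) claims are never citable.»

WHY: TT6 (v) `W2OfK_conj_psiKS` displays the (W-pair) word of the conjugated kernel as `vertex2OfK K n T₂`, `T₂ α x := slotPsiS r n (slotPsiS r n S₂ α x)`, and §5
`slotPsiS₂_expand` writes `T₂ − S₂` as the three block-indexed pieces of «PAIR-FACE-PACK».  With «PAIR-FACE-SUM-MASS» the three pieces' `hTB` letters need only
`hBm`; `blockPairTotal_add_le` (twice) adds them: at a faceWt root `r` with block-ℓ¹ law `≤ N·cW` the CONTACT family has block-pair totals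
`≤ N⁸·((16·cW + 64·cW²)·e^{8θ}·mB j i)·e^{−θ|y₂−y₁|₁}`, the transported family `≤ N⁸·((1 + 16·cW + 64·cW²)·e^{8θ}·mB j i)·e^{−θ|y₂−y₁|₁}`, and FILE 6 §3 turns either into
the (M-b) packed bi-vertex row at the weights `G₀^{bm}(r′)` (any in-block root `r′`), rate `min (κ′∕8) (θ∕2)`.  At `ρ_c`: `1088 = 16·4 + 64·4²`.  What remains displayed:
`hBm ∕ hBs` of the RAW pair table (d1-leaf-01's `PackedRoadRowsMassPairs` per-slot-pair letters' shape) — the face-sum letters of «PAIR-FACE-PACK» are no longer inputs.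

CONTENT ([folklore], `d = 3`, `[NeZero N]`).  §3a (no letter): `transported_sub_eq_pieces`, `blk_add₃` (d1-p3's `FP/SymJetBlockRows.blk_add` is the two-term twin), `l1_sub_nsmul_blk_le`, `blockPairTotal_contact_eq`.
§3b (from `hBm`): `summable_outer_piece ∕ summable_inner_piece ∕ summable_both_piece ∕ summable_contact ∕ summable_transported`, `blockPairTotal_pieces_step₁ ∕ _step₂`;
(+ `hcB`): `blockPairTotal_outer_le ∕ _inner_le ∕ _both_le`, **`hTB_contact_of_hBm`**, **`hTB_transported_of_hBm`**, **`mass_blk_vertex2OfK_G₀_contact_le_of_hBm`**,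
**`mass_blk_vertex2OfK_G₀_transported_le_of_hBm`**.  §4 (centred root): **`hTB_contact_ctrOff_of_hBm`**, **`mass_blk_vertex2OfK_G₀_contact_ctrOff_le_of_hBm`**.
Unit `b2b-balaban-gan24-formalise-leaf-05` (gen 59), G-an2-4 swarm leaf prover 05, road «BF-x» supplier; INTENT-1 «PAIR-FACE-SUM-MASS ∕ PAIR-FACE-CONTACT» (journal).
-/

noncomputable section

open Finset
open scoped BigOperators
open Literature.MathematicalPhysics.QuantumFieldTheory
open Literature.MathematicalPhysics.QuantumFieldTheory.Balaban1983to89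
open Literature.MathematicalPhysics.QuantumFieldTheory.Balaban1983to89.Beta
open B12Sec2to5 (l1 l1_nonneg)
open B5Hk163Strip (kappa163 kappa163_pos)
open B5Hk163Decay (MG163)
open B4TorusKernel (periodConst)
open ExpKernelCalculus (Site MKer Zl)
open AffineAveraging (box toSite)
open AveragingContoursRooted (ctrOff)
open OneStepResolventKernel (Fib)
open OneStepKernelFamily (KInvStep)
open SecondOrderResponse (vertex2OfK)
open Summit.QuantumFields.BalabanUV.Beta.AxialDressingRooted (coDressKBmAt)
open Summit.QuantumFields.BalabanUV.Beta.D1BFx.PackedKernelSplit (blk)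
open Summit.QuantumFields.BalabanUV.Beta.SymCorrectorFace (faceWt faceSum slotPsiS)
open Summit.QuantumFields.BalabanUV.Beta.SymCorrectorRest (slotPsiS₂_expand)
open Summit.QuantumFields.BalabanUV.Beta.D1BFx.PackedPairBlockIndexedMass (blockPairTotal_add_le hTB_of_outerIndexed hTB_of_innerIndexed hTB_of_bothIndexed)
open Summit.QuantumFields.BalabanUV.Beta.D1BFx.PackedColumnBlockTotalScales (mass_blk_vertex2OfK_G₀_le_of_blockPairTotal_at)
open Summit.QuantumFields.BalabanUV.Beta.D1BFx.PackedPairFaceSumMass (exp_pairSlot_le_four l1_sub_nsmul_le_of_mem_box sum_box_abs_faceWt_ctrOff_le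
  mass_blk_faceSum_outer_le mass_blk_faceSum_inner_le hGB_of_hBm hHB_of_hBm hJB_of_hBm)

namespace Summit.QuantumFields.BalabanUV.Beta.D1BFx.PackedPairFaceContactMass

/-! ## §3 The contact family `Ψ̂_S∘Ψ̂_S S₂ − S₂` and the transported family `Ψ̂_S∘Ψ̂_S S₂`: ONE `hTB` and ONE (M-b) packed bi-vertex row each -/

section Pieces

/-- [folklore] **THE CONTACT FAMILY IS THE SUM OF THE THREE PIECES** (TT6 §5 `slotPsiS₂_expand`, the raw table moved to the left):
`Ψ̂_S(Ψ̂_S S₂ α x) κ′ u′ − S₂ α x κ′ u′ = faceWt α x • faceSum N S₂ (blk x) κ′ u′ + faceWt κ′ u′ • faceSum N (S₂ α x) (blk u′) + (faceWt α x·faceWt κ′ u′) • faceSum N (faceSum N S₂ (blk x)) (blk u′)`. -/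
theorem transported_sub_eq_pieces (N : ℕ) (r : Fin (3 + 1) → ℕ) (S₂ : Fin 4 → Site 4 → Fin 4 → Site 4 → MKer 4 (Fib 3))
    (α : Fin 4) (x : Site 4) (κ' : Fin 4) (u' : Site 4) :
    slotPsiS (d := 3) r N (slotPsiS (d := 3) r N S₂ α x) κ' u' - S₂ α x κ' u'
      = faceWt (d := 3) r N α x • faceSum (d := 3) N S₂ (AveragingContours.blk N x) κ' u'
        + faceWt (d := 3) r N κ' u' • faceSum (d := 3) N (S₂ α x) (AveragingContours.blk N u')
        + (faceWt (d := 3) r N α x * faceWt (d := 3) r N κ' u')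
            • faceSum (d := 3) N (faceSum (d := 3) N S₂ (AveragingContours.blk N x)) (AveragingContours.blk N u') := by
  rw [slotPsiS₂_expand]; abel

/-- [our object] The blocks of a three-term sum of packed tables (definitional). -/
theorem blk_add₃ (X Y Z : MKer 4 (Fib 3)) (j k : Bool) : blk (X + Y + Z) j k = blk X j k + blk Y j k + blk Z j k := rfl

/-- [folklore] Every slot lies within `(3+1)·N` of the corner `N•blk N u` of its own block (`u = N•blk N u + toSite (off N u)`). -/
theorem l1_sub_nsmul_blk_le (N : ℕ) [NeZero N] (u : Site 4) : l1 (u - (N : ℤ) • AveragingContours.blk N u) ≤ ((3 + 1 : ℕ) : ℝ) * (N : ℝ) := by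
  have hN1 : 1 ≤ N := Nat.pos_of_ne_zero (NeZero.ne N)
  have h := l1_sub_nsmul_le_of_mem_box (D := 4) (AveragingContours.blk N u) (AveragingContours.off_mem_box hN1 u)
  rw [AveragingContours.blk_add_off hN1 u] at h
  exact h.trans (le_of_eq (by norm_num))

/-- [folklore] **THE CONTACT FAMILY'S BLOCK-PAIR TOTALS ARE THOSE OF THE SUM OF THE THREE PIECES' BLOCKS** (termwise `transported_sub_eq_pieces` + `blk_add₃`). -/
theorem blockPairTotal_contact_eq (N : ℕ) (r : Fin (3 + 1) → ℕ) (S₂ : Fin 4 → Site 4 → Fin 4 → Site 4 → MKer 4 (Fib 3))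
    (κ κ' : Fin 4) (y₁ y₂ : Site 4) (j i : Bool) :
    ∑ b ∈ box 4 N, ∑ b' ∈ box 4 N, (∑' p : Site 4 × Site 4, ∑ g, ∑ f,
          |blk (slotPsiS (d := 3) r N (slotPsiS (d := 3) r N S₂ κ (((N : ℕ) : ℤ) • y₁ + toSite b)) κ' (((N : ℕ) : ℤ) • y₂ + toSite b')
              - S₂ κ (((N : ℕ) : ℤ) • y₁ + toSite b) κ' (((N : ℕ) : ℤ) • y₂ + toSite b')) j i p.1 p.2 g f|)
      = ∑ b ∈ box 4 N, ∑ b' ∈ box 4 N, (∑' p : Site 4 × Site 4, ∑ g, ∑ f,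
          |(blk (faceWt (d := 3) r N κ (((N : ℕ) : ℤ) • y₁ + toSite b) • faceSum (d := 3) N S₂ (AveragingContours.blk N (((N : ℕ) : ℤ) • y₁ + toSite b)) κ' (((N : ℕ) : ℤ) • y₂ + toSite b')) j i + blk (faceWt (d := 3) r N κ' (((N : ℕ) : ℤ) • y₂ + toSite b') • faceSum (d := 3) N (S₂ κ (((N : ℕ) : ℤ) • y₁ + toSite b)) (AveragingContours.blk N (((N : ℕ) : ℤ) • y₂ + toSite b'))) j i
            + blk ((faceWt (d := 3) r N κ (((N : ℕ) : ℤ) • y₁ + toSite b) * faceWt (d := 3) r N κ' (((N : ℕ) : ℤ) • y₂ + toSite b'))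
              • faceSum (d := 3) N (faceSum (d := 3) N S₂ (AveragingContours.blk N (((N : ℕ) : ℤ) • y₁ + toSite b))) (AveragingContours.blk N (((N : ℕ) : ℤ) • y₂ + toSite b'))) j i) p.1 p.2 g f|) :=
  Finset.sum_congr rfl fun b _ => Finset.sum_congr rfl fun b' _ => by rw [transported_sub_eq_pieces, blk_add₃]

end Pieces

section Contact

variable (N : ℕ) [NeZero N] (r : Fin (3 + 1) → ℕ) {S₂ : Fin 4 → Site 4 → Fin 4 → Site 4 → MKer 4 (Fib 3)} {θ cW : ℝ} {mB : Bool → Bool → ℝ}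
  (hθ : 0 ≤ θ) (hmB : ∀ j i, 0 ≤ mB j i)
  (hBs : ∀ κ u κ' u' j i, Summable fun p : Site 4 × Site 4 => ∑ g, ∑ f, |blk (S₂ κ u κ' u') j i p.1 p.2 g f|)
  (hBm : ∀ κ u κ' u' j i, ∑' p : Site 4 × Site 4, ∑ g, ∑ f, |blk (S₂ κ u κ' u') j i p.1 p.2 g f|
    ≤ mB j i * Real.exp (-(θ / (N : ℝ)) * l1 (u' - u)))
include hθ hmB hBs hBm

/-- [folklore] **THE OUTER PIECE IS SUMMABLE AT EVERY SLOT PAIR** (plain block masses). -/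
theorem summable_outer_piece (κ : Fin 4) (u : Site 4) (κ' : Fin 4) (u' : Site 4) (j i : Bool) :
    Summable fun p : Site 4 × Site 4 => ∑ g, ∑ f,
      |blk (faceWt (d := 3) r N κ u • faceSum (d := 3) N S₂ (AveragingContours.blk N u) κ' u') j i p.1 p.2 g f| :=
  (PackedCoframeSep.mass_smul_le (faceWt (d := 3) r N κ u)
    (mass_blk_faceSum_outer_le N hθ hmB hBs hBm (AveragingContours.blk N u) (AveragingContours.blk N u') κ'
      (l1_sub_nsmul_blk_le N u') j i).1).1

/-- [folklore] **THE INNER PIECE IS SUMMABLE AT EVERY SLOT PAIR.** -/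
theorem summable_inner_piece (κ : Fin 4) (u : Site 4) (κ' : Fin 4) (u' : Site 4) (j i : Bool) :
    Summable fun p : Site 4 × Site 4 => ∑ g, ∑ f,
      |blk (faceWt (d := 3) r N κ' u' • faceSum (d := 3) N (S₂ κ u) (AveragingContours.blk N u')) j i p.1 p.2 g f| :=
  (PackedCoframeSep.mass_smul_le (faceWt (d := 3) r N κ' u')
    (mass_blk_faceSum_inner_le N hθ hmB hBs hBm (AveragingContours.blk N u) (AveragingContours.blk N u') κ
      (l1_sub_nsmul_blk_le N u) j i).1).1

/-- [folklore] **THE FACE × FACE PIECE IS SUMMABLE AT EVERY SLOT PAIR.** -/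
theorem summable_both_piece (κ : Fin 4) (u : Site 4) (κ' : Fin 4) (u' : Site 4) (j i : Bool) :
    Summable fun p : Site 4 × Site 4 => ∑ g, ∑ f,
      |blk ((faceWt (d := 3) r N κ u * faceWt (d := 3) r N κ' u')
          • faceSum (d := 3) N (faceSum (d := 3) N S₂ (AveragingContours.blk N u)) (AveragingContours.blk N u')) j i p.1 p.2 g f| :=
  (PackedCoframeSep.mass_smul_le (faceWt (d := 3) r N κ u * faceWt (d := 3) r N κ' u')
    (hJB_of_hBm N hθ hmB hBs hBm (AveragingContours.blk N u) (AveragingContours.blk N u') j i).1).1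

/-- [folklore] **THE CONTACT FAMILY IS SUMMABLE AT EVERY SLOT PAIR** (the `hTs` input of FILE 6 §3 for `Ψ̂_S∘Ψ̂_S S₂ − S₂`). -/
theorem summable_contact (κ : Fin 4) (u : Site 4) (κ' : Fin 4) (u' : Site 4) (j i : Bool) :
    Summable fun p : Site 4 × Site 4 => ∑ g, ∑ f,
      |blk (slotPsiS (d := 3) r N (slotPsiS (d := 3) r N S₂ κ u) κ' u' - S₂ κ u κ' u') j i p.1 p.2 g f| := by
  rw [transported_sub_eq_pieces, blk_add₃]
  exact (PackedCoframeSep.mass_add_le (PackedCoframeSep.mass_add_le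
    (summable_outer_piece N r hθ hmB hBs hBm κ u κ' u' j i) (summable_inner_piece N r hθ hmB hBs hBm κ u κ' u' j i)).1
    (summable_both_piece N r hθ hmB hBs hBm κ u κ' u' j i)).1

/-- [folklore] **THE TRANSPORTED FAMILY IS SUMMABLE AT EVERY SLOT PAIR** (the `hTs` input of FILE 6 §3 for `Ψ̂_S∘Ψ̂_S S₂`). -/
theorem summable_transported (κ : Fin 4) (u : Site 4) (κ' : Fin 4) (u' : Site 4) (j i : Bool) :
    Summable fun p : Site 4 × Site 4 => ∑ g, ∑ f,
      |blk (slotPsiS (d := 3) r N (slotPsiS (d := 3) r N S₂ κ u) κ' u') j i p.1 p.2 g f| := by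
  have e : slotPsiS (d := 3) r N (slotPsiS (d := 3) r N S₂ κ u) κ' u'
      = S₂ κ u κ' u' + (slotPsiS (d := 3) r N (slotPsiS (d := 3) r N S₂ κ u) κ' u' - S₂ κ u κ' u') := by abel
  have hba : ∀ X Y : MKer 4 (Fib 3), blk (X + Y) j i = blk X j i + blk Y j i := fun _ _ => rfl
  rw [e, hba]
  exact (PackedCoframeSep.mass_add_le (hBs κ u κ' u' j i) (summable_contact N r hθ hmB hBs hBm κ u κ' u' j i)).1

/-- [folklore] Subadditivity step 1: the three blocks' sum against (outer + inner) and face × face (`blockPairTotal_add_le`). -/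
theorem blockPairTotal_pieces_step₁ (κ κ' : Fin 4) (y₁ y₂ : Site 4) (j i : Bool) :
    ∑ b ∈ box 4 N, ∑ b' ∈ box 4 N, (∑' p : Site 4 × Site 4, ∑ g, ∑ f,
          |(blk (faceWt (d := 3) r N κ (((N : ℕ) : ℤ) • y₁ + toSite b) • faceSum (d := 3) N S₂ (AveragingContours.blk N (((N : ℕ) : ℤ) • y₁ + toSite b)) κ' (((N : ℕ) : ℤ) • y₂ + toSite b')) j i + blk (faceWt (d := 3) r N κ' (((N : ℕ) : ℤ) • y₂ + toSite b') • faceSum (d := 3) N (S₂ κ (((N : ℕ) : ℤ) • y₁ + toSite b)) (AveragingContours.blk N (((N : ℕ) : ℤ) • y₂ + toSite b'))) j i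
            + blk ((faceWt (d := 3) r N κ (((N : ℕ) : ℤ) • y₁ + toSite b) * faceWt (d := 3) r N κ' (((N : ℕ) : ℤ) • y₂ + toSite b'))
              • faceSum (d := 3) N (faceSum (d := 3) N S₂ (AveragingContours.blk N (((N : ℕ) : ℤ) • y₁ + toSite b))) (AveragingContours.blk N (((N : ℕ) : ℤ) • y₂ + toSite b'))) j i) p.1 p.2 g f|)
      ≤ (∑ b ∈ box 4 N, ∑ b' ∈ box 4 N, (∑' p : Site 4 × Site 4, ∑ g, ∑ f,
          |(blk (faceWt (d := 3) r N κ (((N : ℕ) : ℤ) • y₁ + toSite b) • faceSum (d := 3) N S₂ (AveragingContours.blk N (((N : ℕ) : ℤ) • y₁ + toSite b)) κ' (((N : ℕ) : ℤ) • y₂ + toSite b')) j i + blk (faceWt (d := 3) r N κ' (((N : ℕ) : ℤ) • y₂ + toSite b') • faceSum (d := 3) N (S₂ κ (((N : ℕ) : ℤ) • y₁ + toSite b)) (AveragingContours.blk N (((N : ℕ) : ℤ) • y₂ + toSite b'))) j i) p.1 p.2 g f|))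
        + ∑ b ∈ box 4 N, ∑ b' ∈ box 4 N, (∑' p : Site 4 × Site 4, ∑ g, ∑ f,
          |blk ((faceWt (d := 3) r N κ (((N : ℕ) : ℤ) • y₁ + toSite b) * faceWt (d := 3) r N κ' (((N : ℕ) : ℤ) • y₂ + toSite b'))
              • faceSum (d := 3) N (faceSum (d := 3) N S₂ (AveragingContours.blk N (((N : ℕ) : ℤ) • y₁ + toSite b))) (AveragingContours.blk N (((N : ℕ) : ℤ) • y₂ + toSite b'))) j i p.1 p.2 g f|) := by
  have s1 := (blockPairTotal_add_le (n := N) (P := fun u u' => blk (faceWt (d := 3) r N κ u • faceSum (d := 3) N S₂ (AveragingContours.blk N u) κ' u') j i) (Q := fun u u' => blk (faceWt (d := 3) r N κ' u' • faceSum (d := 3) N (S₂ κ u) (AveragingContours.blk N u')) j i) y₁ y₂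
    (fun u u' => summable_outer_piece N r hθ hmB hBs hBm κ u κ' u' j i) (fun u u' => summable_inner_piece N r hθ hmB hBs hBm κ u κ' u' j i)).1
  exact (blockPairTotal_add_le (n := N) (P := fun u u' => blk (faceWt (d := 3) r N κ u • faceSum (d := 3) N S₂ (AveragingContours.blk N u) κ' u') j i + blk (faceWt (d := 3) r N κ' u' • faceSum (d := 3) N (S₂ κ u) (AveragingContours.blk N u')) j i)
    (Q := fun u u' => blk ((faceWt (d := 3) r N κ u * faceWt (d := 3) r N κ' u')
      • faceSum (d := 3) N (faceSum (d := 3) N S₂ (AveragingContours.blk N u)) (AveragingContours.blk N u')) j i) y₁ y₂ s1 (fun u u' => summable_both_piece N r hθ hmB hBs hBm κ u κ' u' j i)).2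

/-- [folklore] Subadditivity step 2: outer against inner (`blockPairTotal_add_le`). -/
theorem blockPairTotal_pieces_step₂ (κ κ' : Fin 4) (y₁ y₂ : Site 4) (j i : Bool) :
    ∑ b ∈ box 4 N, ∑ b' ∈ box 4 N, (∑' p : Site 4 × Site 4, ∑ g, ∑ f,
          |(blk (faceWt (d := 3) r N κ (((N : ℕ) : ℤ) • y₁ + toSite b) • faceSum (d := 3) N S₂ (AveragingContours.blk N (((N : ℕ) : ℤ) • y₁ + toSite b)) κ' (((N : ℕ) : ℤ) • y₂ + toSite b')) j i + blk (faceWt (d := 3) r N κ' (((N : ℕ) : ℤ) • y₂ + toSite b') • faceSum (d := 3) N (S₂ κ (((N : ℕ) : ℤ) • y₁ + toSite b)) (AveragingContours.blk N (((N : ℕ) : ℤ) • y₂ + toSite b'))) j i) p.1 p.2 g f|)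
      ≤ (∑ b ∈ box 4 N, ∑ b' ∈ box 4 N, (∑' p : Site 4 × Site 4, ∑ g, ∑ f,
          |blk (faceWt (d := 3) r N κ (((N : ℕ) : ℤ) • y₁ + toSite b) • faceSum (d := 3) N S₂ (AveragingContours.blk N (((N : ℕ) : ℤ) • y₁ + toSite b)) κ' (((N : ℕ) : ℤ) • y₂ + toSite b')) j i p.1 p.2 g f|))
        + ∑ b ∈ box 4 N, ∑ b' ∈ box 4 N, (∑' p : Site 4 × Site 4, ∑ g, ∑ f,
          |blk (faceWt (d := 3) r N κ' (((N : ℕ) : ℤ) • y₂ + toSite b') • faceSum (d := 3) N (S₂ κ (((N : ℕ) : ℤ) • y₁ + toSite b)) (AveragingContours.blk N (((N : ℕ) : ℤ) • y₂ + toSite b'))) j i p.1 p.2 g f|) :=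
  (blockPairTotal_add_le (n := N) (P := fun u u' => blk (faceWt (d := 3) r N κ u • faceSum (d := 3) N S₂ (AveragingContours.blk N u) κ' u') j i) (Q := fun u u' => blk (faceWt (d := 3) r N κ' u' • faceSum (d := 3) N (S₂ κ u) (AveragingContours.blk N u')) j i) y₁ y₂
    (fun u u' => summable_outer_piece N r hθ hmB hBs hBm κ u κ' u' j i) (fun u u' => summable_inner_piece N r hθ hmB hBs hBm κ u κ' u' j i)).2

variable (hcW : 0 ≤ cW)
  (hcB : ∀ (κ : Fin 4) (y : Site 4), ∑ b ∈ box 4 N, |faceWt (d := 3) r N κ (((N : ℕ) : ℤ) • y + toSite b)| ≤ (N : ℝ) * cW)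
include hcW hcB

/-- [folklore] **THE OUTER PIECE'S BLOCK-PAIR TOTALS** (`d = 3`, faceWt root `r` with a DISPLAYED block-ℓ¹ law `Σ_b |faceWt r N κ (N•y+b)| ≤ N·cW`):
`≤ N⁸·(cW·(8·e^{8θ}·mB j i))·e^{−θ|y₂ − y₁|₁}` («PAIR-FACE-PACK» `hTB_of_outerIndexed` with §2's `hGB_of_hBm`). -/
theorem blockPairTotal_outer_le (κ κ' : Fin 4) (y₁ y₂ : Site 4) (j i : Bool) :
    ∑ b ∈ box 4 N, ∑ b' ∈ box 4 N, (∑' p : Site 4 × Site 4, ∑ g, ∑ f,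
        |blk (faceWt (d := 3) r N κ (((N : ℕ) : ℤ) • y₁ + toSite b)
              • faceSum (d := 3) N S₂ (AveragingContours.blk N (((N : ℕ) : ℤ) • y₁ + toSite b)) κ' (((N : ℕ) : ℤ) • y₂ + toSite b')) j i p.1 p.2 g f|)
      ≤ (N : ℝ) ^ 8 * (cW * (8 * Real.exp (8 * θ) * mB j i)) * Real.exp (-θ * l1 (y₂ - y₁)) :=
  hTB_of_outerIndexed N
    (P := fun κ x κ' u' => faceWt (d := 3) r N κ x • faceSum (d := 3) N S₂ (AveragingContours.blk N x) κ' u')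
    (c := fun κ x => faceWt (d := 3) r N κ x) (G := fun _ y₁ κ' u' => faceSum (d := 3) N S₂ y₁ κ' u') (θ := θ)
    (mG := fun j i => 8 * Real.exp (8 * θ) * mB j i) hcW
    (fun κ y₁ b hb κ' u' => by rw [AveragingContours.blk_block y₁ hb])
    (fun _ y₁ κ' u' j i => (mass_blk_faceSum_outer_le N hθ hmB hBs hBm y₁ (AveragingContours.blk N u') κ' (l1_sub_nsmul_blk_le N u') j i).1)
    hcB (fun _ κ' y₁ y₂ j i => hGB_of_hBm N hθ hmB hBs hBm κ' y₁ y₂ j i) κ κ' y₁ y₂ j i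

/-- [folklore] **THE INNER PIECE'S BLOCK-PAIR TOTALS**: `≤ N⁸·(cW·(8·e^{8θ}·mB j i))·e^{−θ|y₂ − y₁|₁}` (`hTB_of_innerIndexed` with `hHB_of_hBm`). -/
theorem blockPairTotal_inner_le (κ κ' : Fin 4) (y₁ y₂ : Site 4) (j i : Bool) :
    ∑ b ∈ box 4 N, ∑ b' ∈ box 4 N, (∑' p : Site 4 × Site 4, ∑ g, ∑ f,
        |blk (faceWt (d := 3) r N κ' (((N : ℕ) : ℤ) • y₂ + toSite b')
              • faceSum (d := 3) N (S₂ κ (((N : ℕ) : ℤ) • y₁ + toSite b)) (AveragingContours.blk N (((N : ℕ) : ℤ) • y₂ + toSite b'))) j i p.1 p.2 g f|)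
      ≤ (N : ℝ) ^ 8 * (cW * (8 * Real.exp (8 * θ) * mB j i)) * Real.exp (-θ * l1 (y₂ - y₁)) :=
  hTB_of_innerIndexed N
    (P := fun κ x κ' u' => faceWt (d := 3) r N κ' u' • faceSum (d := 3) N (S₂ κ x) (AveragingContours.blk N u'))
    (c := fun κ' u' => faceWt (d := 3) r N κ' u') (H := fun κ u _ y₂ => faceSum (d := 3) N (S₂ κ u) y₂) (θ := θ)
    (mH := fun j i => 8 * Real.exp (8 * θ) * mB j i) hcW
    (fun κ u κ' y₂ b' hb' => by rw [AveragingContours.blk_block y₂ hb'])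
    (fun κ u _ y₂ j i => (mass_blk_faceSum_inner_le N hθ hmB hBs hBm (AveragingContours.blk N u) y₂ κ (l1_sub_nsmul_blk_le N u) j i).1)
    hcB (fun κ _ y₁ y₂ j i => hHB_of_hBm N hθ hmB hBs hBm κ y₁ y₂ j i) κ κ' y₁ y₂ j i

/-- [folklore] **THE FACE × FACE PIECE'S BLOCK-PAIR TOTALS**: `≤ N⁸·(cW²·(64·e^{8θ}·mB j i))·e^{−θ|y₂ − y₁|₁}` (`hTB_of_bothIndexed` with `hJB_of_hBm`). -/
theorem blockPairTotal_both_le (κ κ' : Fin 4) (y₁ y₂ : Site 4) (j i : Bool) :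
    ∑ b ∈ box 4 N, ∑ b' ∈ box 4 N, (∑' p : Site 4 × Site 4, ∑ g, ∑ f,
        |blk ((faceWt (d := 3) r N κ (((N : ℕ) : ℤ) • y₁ + toSite b) * faceWt (d := 3) r N κ' (((N : ℕ) : ℤ) • y₂ + toSite b'))
              • faceSum (d := 3) N (faceSum (d := 3) N S₂ (AveragingContours.blk N (((N : ℕ) : ℤ) • y₁ + toSite b)))
                  (AveragingContours.blk N (((N : ℕ) : ℤ) • y₂ + toSite b'))) j i p.1 p.2 g f|)
      ≤ (N : ℝ) ^ 8 * (cW ^ 2 * (64 * Real.exp (8 * θ) * mB j i)) * Real.exp (-θ * l1 (y₂ - y₁)) :=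
  hTB_of_bothIndexed N
    (P := fun κ x κ' u' => (faceWt (d := 3) r N κ x * faceWt (d := 3) r N κ' u')
      • faceSum (d := 3) N (faceSum (d := 3) N S₂ (AveragingContours.blk N x)) (AveragingContours.blk N u'))
    (c := fun κ x => faceWt (d := 3) r N κ x) (J := fun _ y₁ _ y₂ => faceSum (d := 3) N (faceSum (d := 3) N S₂ y₁) y₂) (θ := θ)
    (mJ := fun j i => 64 * Real.exp (8 * θ) * mB j i) hcW
    (fun κ y₁ b hb κ' y₂ b' hb' => by rw [AveragingContours.blk_block y₁ hb, AveragingContours.blk_block y₂ hb'])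
    (fun _ y₁ _ y₂ j i => (hJB_of_hBm N hθ hmB hBs hBm y₁ y₂ j i).1)
    hcB (fun _ _ y₁ y₂ j i => (hJB_of_hBm N hθ hmB hBs hBm y₁ y₂ j i).2) κ κ' y₁ y₂ j i

/-- [folklore] **ONE `hTB` FOR THE CONTACT FAMILY** (`d = 3`, faceWt root `r` with a DISPLAYED block-ℓ¹ law `Σ_b |faceWt r N κ (N•y+b)| ≤ N·cW`): from `hBm` alone, the
block-pair totals of `Ψ̂_S∘Ψ̂_S S₂ − S₂` are `≤ N⁸·((16·cW + 64·cW²)·e^{8θ}·mB j i)·e^{−θ|y₂ − y₁|₁}` (the three pieces' totals, `blockPairTotal_add_le` twice). -/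
theorem hTB_contact_of_hBm (κ κ' : Fin 4) (y₁ y₂ : Site 4) (j i : Bool) :
    ∑ b ∈ box 4 N, ∑ b' ∈ box 4 N, (∑' p : Site 4 × Site 4, ∑ g, ∑ f,
          |blk (slotPsiS (d := 3) r N (slotPsiS (d := 3) r N S₂ κ (((N : ℕ) : ℤ) • y₁ + toSite b)) κ' (((N : ℕ) : ℤ) • y₂ + toSite b')
              - S₂ κ (((N : ℕ) : ℤ) • y₁ + toSite b) κ' (((N : ℕ) : ℤ) • y₂ + toSite b')) j i p.1 p.2 g f|)
      ≤ (N : ℝ) ^ 8 * ((16 * cW + 64 * cW ^ 2) * Real.exp (8 * θ) * mB j i) * Real.exp (-θ * l1 (y₂ - y₁)) := by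
  have hO := blockPairTotal_outer_le N r hθ hmB hBs hBm hcW hcB κ κ' y₁ y₂ j i
  have hI := blockPairTotal_inner_le N r hθ hmB hBs hBm hcW hcB κ κ' y₁ y₂ j i
  have hB := blockPairTotal_both_le N r hθ hmB hBs hBm hcW hcB κ κ' y₁ y₂ j i
  have t₁ := blockPairTotal_pieces_step₁ N r hθ hmB hBs hBm κ κ' y₁ y₂ j i
  have t₂ := blockPairTotal_pieces_step₂ N r hθ hmB hBs hBm κ κ' y₁ y₂ j i
  rw [blockPairTotal_contact_eq]
  have e : (N : ℝ) ^ 8 * (cW * (8 * Real.exp (8 * θ) * mB j i)) * Real.exp (-θ * l1 (y₂ - y₁))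
      + (N : ℝ) ^ 8 * (cW * (8 * Real.exp (8 * θ) * mB j i)) * Real.exp (-θ * l1 (y₂ - y₁))
      + (N : ℝ) ^ 8 * (cW ^ 2 * (64 * Real.exp (8 * θ) * mB j i)) * Real.exp (-θ * l1 (y₂ - y₁))
      = (N : ℝ) ^ 8 * ((16 * cW + 64 * cW ^ 2) * Real.exp (8 * θ) * mB j i) * Real.exp (-θ * l1 (y₂ - y₁)) := by ring
  linarith

/-- [folklore] **ONE `hTB` FOR THE TRANSPORTED FAMILY `Ψ̂_S∘Ψ̂_S S₂`**: `≤ N⁸·((1 + 16·cW + 64·cW²)·e^{8θ}·mB j i)·e^{−θ|y₂ − y₁|₁}` (raw `N⁴·N⁴·e^{8θ}·mB` + contact). -/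
theorem hTB_transported_of_hBm (κ κ' : Fin 4) (y₁ y₂ : Site 4) (j i : Bool) :
    ∑ b ∈ box 4 N, ∑ b' ∈ box 4 N, (∑' p : Site 4 × Site 4, ∑ g, ∑ f,
        |blk (slotPsiS (d := 3) r N (slotPsiS (d := 3) r N S₂ κ (((N : ℕ) : ℤ) • y₁ + toSite b)) κ' (((N : ℕ) : ℤ) • y₂ + toSite b')) j i p.1 p.2 g f|)
      ≤ (N : ℝ) ^ 8 * ((1 + 16 * cW + 64 * cW ^ 2) * Real.exp (8 * θ) * mB j i) * Real.exp (-θ * l1 (y₂ - y₁)) := by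
  have hN0 : 0 < N := Nat.pos_of_ne_zero (NeZero.ne N)
  have hcard : ((box 4 N).card : ℝ) = (N : ℝ) ^ 4 := by
    simp [AffineAveraging.box, Fintype.card_piFinset, Finset.card_range, Finset.prod_const, Finset.card_univ, Fintype.card_fin]
  -- the raw table's block-pair totals
  have hR : ∑ b ∈ box 4 N, ∑ b' ∈ box 4 N, (∑' p : Site 4 × Site 4, ∑ g, ∑ f,
      |blk (S₂ κ (((N : ℕ) : ℤ) • y₁ + toSite b) κ' (((N : ℕ) : ℤ) • y₂ + toSite b')) j i p.1 p.2 g f|)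
        ≤ (N : ℝ) ^ 8 * (Real.exp (8 * θ) * mB j i) * Real.exp (-θ * l1 (y₂ - y₁)) := by
    calc ∑ b ∈ box 4 N, ∑ b' ∈ box 4 N, (∑' p : Site 4 × Site 4, ∑ g, ∑ f,
          |blk (S₂ κ (((N : ℕ) : ℤ) • y₁ + toSite b) κ' (((N : ℕ) : ℤ) • y₂ + toSite b')) j i p.1 p.2 g f|)
        ≤ ∑ _b ∈ box 4 N, ∑ _b' ∈ box 4 N, mB j i * (Real.exp (8 * θ) * Real.exp (-θ * l1 (y₂ - y₁))) :=
          Finset.sum_le_sum fun b hb => Finset.sum_le_sum fun b' hb' => (hBm κ _ κ' _ j i).trans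
            (mul_le_mul_of_nonneg_left (exp_pairSlot_le_four hN0 hθ y₁ y₂
              ((l1_sub_nsmul_le_of_mem_box y₁ hb).trans (le_of_eq (by norm_num)))
              ((l1_sub_nsmul_le_of_mem_box y₂ hb').trans (le_of_eq (by norm_num)))) (hmB j i))
      _ = (N : ℝ) ^ 8 * (Real.exp (8 * θ) * mB j i) * Real.exp (-θ * l1 (y₂ - y₁)) := by
          rw [Finset.sum_const, nsmul_eq_mul, Finset.sum_const, nsmul_eq_mul, hcard]; ring
  have hC := hTB_contact_of_hBm N r hθ hmB hBs hBm hcW hcB κ κ' y₁ y₂ j i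
  have s := blockPairTotal_add_le (n := N) (P := fun u u' => blk (S₂ κ u κ' u') j i)
    (Q := fun u u' => blk (slotPsiS (d := 3) r N (slotPsiS (d := 3) r N S₂ κ u) κ' u' - S₂ κ u κ' u') j i) y₁ y₂
    (fun u u' => hBs κ u κ' u' j i) (fun u u' => summable_contact N r hθ hmB hBs hBm κ u κ' u' j i)
  have e : ∀ (X Y : MKer 4 (Fib 3)), blk Y j i = blk X j i + blk (Y - X) j i := by
    intro X Y
    have hba : blk (X + (Y - X)) j i = blk X j i + blk (Y - X) j i := rfl
    rw [← hba, add_sub_cancel]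
  rw [Finset.sum_congr rfl fun b _ => Finset.sum_congr rfl fun b' _ => by
    rw [e (S₂ κ (((N : ℕ) : ℤ) • y₁ + toSite b) κ' (((N : ℕ) : ℤ) • y₂ + toSite b'))]]
  refine s.2.trans ((add_le_add hR hC).trans (le_of_eq ?_))
  ring

/-- [folklore] **«PAIR-FACE-CONTACT»: THE (M-b) PACKED BI-VERTEX ROW OF THE CONTACT FAMILY** at the weights `G₀^{bm}(r′)` (any in-block root `r′`; faceWt root `r` with its
displayed law; `0 < θ`): every block of `vertex2OfK (G₀^{bm} r′) N (Ψ̂_S∘Ψ̂_S S₂ − S₂) μ y ν y′` has summable plain mass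
`≤ 16·C_{G₀}²·(e^{κ′}·e^{κ′})·(Zl 4 (κ′∕8)·Zl 4 (θ∕2))·((16·cW + 64·cW²)·e^{8θ}·mB j i)·e^{−min (κ′∕8) (θ∕2)|y′−y|₁}` (FILE 6 §3 BY NAME). -/
theorem mass_blk_vertex2OfK_G₀_contact_le_of_hBm {r' : Fin (3 + 1) → ℕ} (hr' : r' ∈ box (3 + 1) N) (hθ' : 0 < θ)
    (μ : Fin 4) (y : Site 4) (ν : Fin 4) (y' : Site 4) (j i : Bool) :
    (Summable fun p : Site 4 × Site 4 => ∑ g, ∑ f,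
        |blk (vertex2OfK (coDressKBmAt (toSite r') N (KInvStep (d := 3) N 0)) N
            (fun κ u κ' u' => slotPsiS (d := 3) r N (slotPsiS (d := 3) r N S₂ κ u) κ' u' - S₂ κ u κ' u') μ y ν y') j i p.1 p.2 g f|) ∧
      ∑' p : Site 4 × Site 4, ∑ g, ∑ f,
          |blk (vertex2OfK (coDressKBmAt (toSite r') N (KInvStep (d := 3) N 0)) N
              (fun κ u κ' u' => slotPsiS (d := 3) r N (slotPsiS (d := 3) r N S₂ κ u) κ' u' - S₂ κ u κ' u') μ y ν y') j i p.1 p.2 g f|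
        ≤ 16 * ((MG163 4 * periodConst (kappa163 4) 3) * (1 + 8 * (1 + Real.exp (kappa163 4 / 4))) * Real.exp (kappa163 4 / 4)) ^ 2
            * (Real.exp (kappa163 4 / 4) * Real.exp (kappa163 4 / 4)) * (Zl 4 (kappa163 4 / 4 / 8) * Zl 4 (θ / 2))
          * ((16 * cW + 64 * cW ^ 2) * Real.exp (8 * θ) * mB j i) * Real.exp (-(min (kappa163 4 / 4 / 8) (θ / 2)) * l1 (y' - y)) :=
  mass_blk_vertex2OfK_G₀_le_of_blockPairTotal_at N hr' hθ'
    (fun κ u κ' u' j i => summable_contact N r hθ hmB hBs hBm κ u κ' u' j i)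
    (fun κ κ' y₁ y₂ j i => hTB_contact_of_hBm N r hθ hmB hBs hBm hcW hcB κ κ' y₁ y₂ j i) μ y ν y' j i

/-- [folklore] **… AND OF THE TRANSPORTED FAMILY** `vertex2OfK (G₀^{bm} r′) N (Ψ̂_S∘Ψ̂_S S₂)` (TT6 (v)'s displayed pair word at `K := G₀^{bm} r′`):
`≤ 16·C_{G₀}²·(e^{κ′}·e^{κ′})·(Zl 4 (κ′∕8)·Zl 4 (θ∕2))·((1 + 16·cW + 64·cW²)·e^{8θ}·mB j i)·e^{−min (κ′∕8) (θ∕2)|y′−y|₁}`. -/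
theorem mass_blk_vertex2OfK_G₀_transported_le_of_hBm {r' : Fin (3 + 1) → ℕ} (hr' : r' ∈ box (3 + 1) N) (hθ' : 0 < θ)
    (μ : Fin 4) (y : Site 4) (ν : Fin 4) (y' : Site 4) (j i : Bool) :
    (Summable fun p : Site 4 × Site 4 => ∑ g, ∑ f,
        |blk (vertex2OfK (coDressKBmAt (toSite r') N (KInvStep (d := 3) N 0)) N
            (fun κ u κ' u' => slotPsiS (d := 3) r N (slotPsiS (d := 3) r N S₂ κ u) κ' u') μ y ν y') j i p.1 p.2 g f|) ∧
      ∑' p : Site 4 × Site 4, ∑ g, ∑ f,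
          |blk (vertex2OfK (coDressKBmAt (toSite r') N (KInvStep (d := 3) N 0)) N
              (fun κ u κ' u' => slotPsiS (d := 3) r N (slotPsiS (d := 3) r N S₂ κ u) κ' u') μ y ν y') j i p.1 p.2 g f|
        ≤ 16 * ((MG163 4 * periodConst (kappa163 4) 3) * (1 + 8 * (1 + Real.exp (kappa163 4 / 4))) * Real.exp (kappa163 4 / 4)) ^ 2
            * (Real.exp (kappa163 4 / 4) * Real.exp (kappa163 4 / 4)) * (Zl 4 (kappa163 4 / 4 / 8) * Zl 4 (θ / 2))
          * ((1 + 16 * cW + 64 * cW ^ 2) * Real.exp (8 * θ) * mB j i) * Real.exp (-(min (kappa163 4 / 4 / 8) (θ / 2)) * l1 (y' - y)) :=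
  mass_blk_vertex2OfK_G₀_le_of_blockPairTotal_at N hr' hθ'
    (fun κ u κ' u' j i => summable_transported N r hθ hmB hBs hBm κ u κ' u' j i)
    (fun κ κ' y₁ y₂ j i => hTB_transported_of_hBm N r hθ hmB hBs hBm hcW hcB κ κ' y₁ y₂ j i) μ y ν y' j i

end Contact

/-! ## §4 At the road's centred root `ρ_c = ctrOff (3+1) N`: the weights' law discharged (`cW = 3+1`, «COMB-WEIGHT-BLOCK-L1») -/

section Centred

variable (N : ℕ) [NeZero N] {S₂ : Fin 4 → Site 4 → Fin 4 → Site 4 → MKer 4 (Fib 3)} {θ : ℝ} {mB : Bool → Bool → ℝ}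
  (hθ : 0 ≤ θ) (hmB : ∀ j i, 0 ≤ mB j i)
  (hBs : ∀ κ u κ' u' j i, Summable fun p : Site 4 × Site 4 => ∑ g, ∑ f, |blk (S₂ κ u κ' u') j i p.1 p.2 g f|)
  (hBm : ∀ κ u κ' u' j i, ∑' p : Site 4 × Site 4, ∑ g, ∑ f, |blk (S₂ κ u κ' u') j i p.1 p.2 g f|
    ≤ mB j i * Real.exp (-(θ / (N : ℝ)) * l1 (u' - u)))
include hθ hmB hBs hBm

/-- [folklore] **THE CONTACT FAMILY'S `hTB` AT THE CENTRED ROOT, FROM `hBm` ALONE**: `≤ N⁸·(1088·e^{8θ}·mB j i)·e^{−θ|y₂ − y₁|₁}` (`1088 = 16·4 + 64·4²`). -/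
theorem hTB_contact_ctrOff_of_hBm (κ κ' : Fin 4) (y₁ y₂ : Site 4) (j i : Bool) :
    ∑ b ∈ box 4 N, ∑ b' ∈ box 4 N, (∑' p : Site 4 × Site 4, ∑ g, ∑ f,
        |blk (slotPsiS (d := 3) (ctrOff (3 + 1) N) N (slotPsiS (d := 3) (ctrOff (3 + 1) N) N S₂ κ (((N : ℕ) : ℤ) • y₁ + toSite b))
                κ' (((N : ℕ) : ℤ) • y₂ + toSite b')
              - S₂ κ (((N : ℕ) : ℤ) • y₁ + toSite b) κ' (((N : ℕ) : ℤ) • y₂ + toSite b')) j i p.1 p.2 g f|)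
      ≤ (N : ℝ) ^ 8 * (1088 * Real.exp (8 * θ) * mB j i) * Real.exp (-θ * l1 (y₂ - y₁)) := by
  have hN1 : 1 ≤ N := Nat.pos_of_ne_zero (NeZero.ne N)
  have h := hTB_contact_of_hBm N (ctrOff (3 + 1) N) hθ hmB hBs hBm (cW := (3 : ℝ) + 1) (by norm_num)
    (fun κ y => (sum_box_abs_faceWt_ctrOff_le (d := 3) hN1 κ y).trans (le_of_eq (by push_cast; ring))) κ κ' y₁ y₂ j i
  refine h.trans (le_of_eq ?_)
  ring

/-- [folklore] **«PAIR-FACE-CONTACT» AT THE CENTRED ROOT: THE (M-b) PACKED BI-VERTEX ROW OF `vertex2OfK (G₀^{bm} r′) N (Ψ̂_S∘Ψ̂_S S₂ − S₂)` FROM `hBm` ALONE**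
(`0 < θ`; any in-block root `r′` of the weights): `≤ 16·C_{G₀}²·(e^{κ′}·e^{κ′})·(Zl 4 (κ′∕8)·Zl 4 (θ∕2))·(1088·e^{8θ}·mB j i)·e^{−min (κ′∕8) (θ∕2)|y′−y|₁}`. -/
theorem mass_blk_vertex2OfK_G₀_contact_ctrOff_le_of_hBm {r' : Fin (3 + 1) → ℕ} (hr' : r' ∈ box (3 + 1) N) (hθ' : 0 < θ)
    (μ : Fin 4) (y : Site 4) (ν : Fin 4) (y' : Site 4) (j i : Bool) :
    (Summable fun p : Site 4 × Site 4 => ∑ g, ∑ f,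
        |blk (vertex2OfK (coDressKBmAt (toSite r') N (KInvStep (d := 3) N 0)) N
            (fun κ u κ' u' => slotPsiS (d := 3) (ctrOff (3 + 1) N) N (slotPsiS (d := 3) (ctrOff (3 + 1) N) N S₂ κ u) κ' u' - S₂ κ u κ' u')
            μ y ν y') j i p.1 p.2 g f|) ∧
      ∑' p : Site 4 × Site 4, ∑ g, ∑ f,
          |blk (vertex2OfK (coDressKBmAt (toSite r') N (KInvStep (d := 3) N 0)) N
              (fun κ u κ' u' => slotPsiS (d := 3) (ctrOff (3 + 1) N) N (slotPsiS (d := 3) (ctrOff (3 + 1) N) N S₂ κ u) κ' u' - S₂ κ u κ' u')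
              μ y ν y') j i p.1 p.2 g f|
        ≤ 16 * ((MG163 4 * periodConst (kappa163 4) 3) * (1 + 8 * (1 + Real.exp (kappa163 4 / 4))) * Real.exp (kappa163 4 / 4)) ^ 2
            * (Real.exp (kappa163 4 / 4) * Real.exp (kappa163 4 / 4)) * (Zl 4 (kappa163 4 / 4 / 8) * Zl 4 (θ / 2))
          * (1088 * Real.exp (8 * θ) * mB j i) * Real.exp (-(min (kappa163 4 / 4 / 8) (θ / 2)) * l1 (y' - y)) :=
  mass_blk_vertex2OfK_G₀_le_of_blockPairTotal_at N hr' hθ'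
    (fun κ u κ' u' j i => summable_contact N (ctrOff (3 + 1) N) hθ hmB hBs hBm κ u κ' u' j i)
    (fun κ κ' y₁ y₂ j i => hTB_contact_ctrOff_of_hBm N hθ hmB hBs hBm κ κ' y₁ y₂ j i) μ y ν y' j i

end Centred

end Summit.QuantumFields.BalabanUV.Beta.D1BFx.PackedPairFaceContactMass

end
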